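import Summits.HodgeConjecture.CorCM.MultiFieldWeilForeignCurves
import Summits.HodgeConjecture.CorCM.SimpleCMFourfoldCurvePowersHodgeOfMarkman
import Literature.AlgebraicGeometry.Pohlmann1968.SimpleCMFourfoldPowersHodgeConjecture
import HarnessLib

/-!
# MULTI-FIELD WEIL ENGINE — ANY CM ELLIPTIC CURVE × ANY SIMPLE CM ABELIAN VARIETY OF DIMENSION `≤ 4`: the Hodge conjecture for every `E^a × B^b`, given ONLY
# Markman's fourfold and hyperbolic-sixfold theorems

Cell `pub-hodgecm2` (COR-CM), seat b30 gen 33 (2026-08-24); count-neutral own lane MULTI-FIELD WEIL ENGINE (stem `MultiFieldWeil*`), sequel of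
`CorCM/MultiFieldWeilForeignCurves.lean` (foreign CM elliptic curves join for free) over gen 19's capstone `CorCM/SimpleCMFourfoldCurvePowersHodgeOfMarkman.lean`
(`SimpleCMFourfoldCurve.hodgeConjectureFor_biproduct_comp_vec_of_isSimple_of_markman`: a SIMPLE CM fourfold `B` whose octic field CONTAINS the curve's field `k`) and
seat lit-deligne-3's `Pohlmann1968/SimpleCMFourfoldPowersHodgeConjecture` (`hodgeConjectureFor_pow_of_markman`: ALL POWERS of every simple CM fourfold, mod Markman's
fourfold theorem).  Theorems only; no definition, no named fact, no `sorry`.  HONEST FRAMING: conditional on the two displayed Markman binders only; `HC_CM` is NOT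
proved and not asserted.

THE STATEMENT (**`hodgeConjectureFor_biproduct_comp_vec_of_cmCurve_simpleFourfold_of_markman`**).  `E ⊨ (k; Ψ)` ANY CM elliptic curve, `B ⊨ (K; Φ)` ANY SIMPLE CM
abelian fourfold (octic CM field `K`) — NOTHING assumed on `k` versus `K`.  Then for every `κ : Fin N → Fin 2` the Hodge conjecture holds for `⨁_j ![E, B] (κ j)` — every
`E^a × B^b` — GIVEN ONLY `Markman2025_weilClasses_algebraic_abelianFourfold` and `Markman2025_weilClasses_algebraic_hyperbolicSixfold`.  Cases: `k ↪ K` — gen 19's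
capstone (Weil classes on `B` of `k`-signature `(2,2)`, mod Markman 4, or on `B × E²` of signature `(1,3)`, mod Markman 6); `k ↪̸ K` — `E` is FOREIGN, splits off
(`hodgeConjectureFor_prod_of_foreignCurves`), and the powers of `B` are lit-deligne-3's theorem (mod Markman 4: the degenerate simple CM fourfolds are of Weil type).
THE ROOF (**`hodgeConjectureFor_biproduct_comp_vec_of_cmCurve_simple_dim_le_four_of_markman`**): ANY CM elliptic curve × ANY SIMPLE CM abelian variety of dimension
`≤ 4` (dimension `≤ 3`: gen 31's G7).  This is the two-factor case `(1, 4)` of the CM fivefolds; with G7 (pairs of dimension `≤ 3`), `CorCM/MultiFieldWeilForeignCurves.lean`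
(`E × E′ × T`) and seat b16's census of curves and surfaces, the products of at most two simple CM factors of total dimension `≤ 5` are covered except `S × T`-free …
— see the census file of this seat for the exact list; nothing beyond the displayed statements is claimed.

[cite: MoonenZarhin1999LowDim, Thm. (0.1), (0.2), §3 (3.1), Cor. (3.9), §5 (5.2)] [cite: Markman2025SurveySecant, Thm. 1.2 and §1.1] [cite: Markman2025SecantWeil, Thm 1.5.1]
[cite: Shimura1998, §8.2 Prop. 26, §8.4] [cite: MumfordAV1970, §19 Thm. 1 and p. 169]

## References
* [MoonenZarhin1999LowDim] B. Moonen, Yu. Zarhin, Math. Ann. 315 (1999) 711–733.  [Markman2025SurveySecant] E. Markman, arXiv:2509.23403.  [Markman2025SecantWeil]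
  E. Markman, arXiv:2502.03415, Thm 1.5.1.  [Shimura1998] G. Shimura, *Abelian varieties with complex multiplication and modular functions*, §8.2, §8.4.
  [MumfordAV1970] D. Mumford, *Abelian Varieties*, §19.
-/

noncomputable section

open CategoryTheory CategoryTheory.Limits NumberField IntermediateField

namespace Summit.HodgeConjecture.CorCM.MultiFieldWeil

open Literature.AlgebraicGeometry Literature.AlgebraicGeometry.Motives Literature.AlgebraicGeometry.HodgeTheory
open Literature.AlgebraicGeometry.ComplexMultiplication (IsCMTypeRealisation isSimple_iff_isPrimitive)
open Literature.AlgebraicTopology.SingularHomology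
open Literature.NumberTheory.ComplexMultiplication

open scoped Classical

section CurveFourfold

variable {k K : Type} [Field k] [NumberField k] [IsCMField k] [Field K] [NumberField K] [IsCMField K] {N : ℕ}
  {E B : AbelianVariety ℂ} {Ψ : CMType k} {Φ : CMType K}
  {ιE : 𝓞 k →+* End E} {θE : k →+* Module.End ℂ (complexBetti E.X 1)}
  {ιB : 𝓞 K →+* End B} {θB : K →+* Module.End ℂ (complexBetti B.X 1)}

omit [NumberField k] [IsCMField k] in
/-- **All powers `⨁_{Fin M} B` of a SIMPLE CM abelian fourfold** satisfy the Hodge conjecture, GIVEN ONLY Markman's fourfold theorem (seat lit-deligne-3's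
`Pohlmann1968.hodgeConjectureFor_pow_of_markman`, the type being primitive because `B` is simple). [cite: Markman2025SurveySecant, §1.1] [cite: Shimura1998, §8.2 Prop. 26] -/
theorem hodgeConjectureFor_biproduct_const_of_simpleFourfold_of_markman (hW4 : Markman2025_weilClasses_algebraic_abelianFourfold) (h8 : Module.finrank ℚ K = 8)
    (hB : IsCMTypeRealisation Φ B ιB θB) (hS : B.IsSimple) (M : ℕ) : HodgeConjectureFor (⨁ fun _ : Fin M => B).dim (⨁ fun _ : Fin M => B).X := by
  obtain ⟨φ₀⟩ : Nonempty (K →+* ℂ) := inferInstance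
  exact Literature.AlgebraicGeometry.Pohlmann1968.hodgeConjectureFor_pow_of_markman hW4 h8 φ₀ ((isSimple_iff_isPrimitive hB φ₀).1 hS) hB M

/-- **`k` FOREIGN to `K`**: the curve splits off (`hodgeConjectureFor_prod_of_foreignCurves` over the powers of `E` and the powers of `B`), GIVEN ONLY Markman's
fourfold theorem. [cite: MoonenZarhin1999LowDim, §3 (3.1), Cor. (3.9)] [cite: Markman2025SurveySecant, §1.1] -/
theorem hodgeConjectureFor_biproduct_comp_vec_of_foreignCurve_simpleFourfold_of_markman (hW4 : Markman2025_weilClasses_algebraic_abelianFourfold)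
    (h2 : Module.finrank ℚ k = 2) (h8 : Module.finrank ℚ K = 8) (hE : IsCMTypeRealisation Ψ E ιE θE) (hB : IsCMTypeRealisation Φ B ιB θB) (hS : B.IsSimple)
    (hkK : IsEmpty (k →+* K)) (κ : Fin N → Fin 2) :
    HodgeConjectureFor (⨁ fun j => (![E, B] : Fin 2 → AbelianVariety ℂ) (κ j)).dim (⨁ fun j => (![E, B] : Fin 2 → AbelianVariety ℂ) (κ j)).X := by
  -- the family of fields `(k, K)` with its instances (all identifications below are definitional)
  let Kf : Fin 2 → Type := Fin.cons k (Fin.cons K finZeroElim)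
  letI instF : ∀ j, Field (Kf j) := Fin.cons ‹Field k› (Fin.cons ‹Field K› finZeroElim)
  letI instN : ∀ j, NumberField (Kf j) := Fin.cons ‹NumberField k› (Fin.cons ‹NumberField K› finZeroElim)
  haveI instC : ∀ j, IsCMField (Kf j) := Fin.cons ‹IsCMField k› (Fin.cons ‹IsCMField K› finZeroElim)
  let Φf : ∀ j : Fin 2, CMType (Kf j) := Fin.cons Ψ (Fin.cons Φ finZeroElim)
  let ιf : ∀ j : Fin 2, 𝓞 (Kf j) →+* End ((![E, B] : Fin 2 → AbelianVariety ℂ) j) := Fin.cons ιE (Fin.cons ιB finZeroElim)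
  let θf : ∀ j : Fin 2, Kf j →+* Module.End ℂ (complexBetti ((![E, B] : Fin 2 → AbelianVariety ℂ) j).X 1) := Fin.cons θE (Fin.cons θB finZeroElim)
  have hA : ∀ j, IsCMTypeRealisation (Φf j) ((![E, B] : Fin 2 → AbelianVariety ℂ) j) (ιf j) (θf j) := Fin.cons hE (Fin.cons hB finZeroElim)
  refine hodgeConjectureFor_prod_of_foreignCurves (K := Kf) (A := (![E, B] : Fin 2 → AbelianVariety ℂ)) hA (fun i => i = 0) ?_ ?_ ⟨0, rfl⟩ ⟨1, by decide⟩ ?_ ?_ κ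
  · intro a ha
    subst ha
    exact h2
  · intro a j ha hj
    subst ha
    fin_cases j
    · exact absurd rfl hj
    · exact hkK
  · -- products of copies of `E`
    intro M ρ hρ
    have hfun : (fun l => (![E, B] : Fin 2 → AbelianVariety ℂ) (ρ l)) = fun _ => E := funext fun l => by rw [hρ l]; rfl
    rw [hfun]
    exact hodgeConjectureFor_biproduct_const_of_cmCurve h2 hE M
  · -- products of copies of `B`
    intro M ρ hρ
    have key : ∀ i : Fin 2, i ≠ 0 → (![E, B] : Fin 2 → AbelianVariety ℂ) i = B := by
      intro i hi
      fin_cases i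
      · exact absurd rfl hi
      · rfl
    have hfun : (fun l => (![E, B] : Fin 2 → AbelianVariety ℂ) (ρ l)) = fun _ => B := funext fun l => key (ρ l) (hρ l)
    rw [hfun]
    exact hodgeConjectureFor_biproduct_const_of_simpleFourfold_of_markman hW4 h8 hB hS M

/-- **MAIN THEOREM — ANY CM ELLIPTIC CURVE × ANY SIMPLE CM ABELIAN FOURFOLD, given ONLY Markman's two theorems.**  `E ⊨ (k; Ψ)` a CM elliptic curve, `B ⊨ (K; Φ)` a
SIMPLE abelian fourfold with CM by an octic CM field — NOTHING assumed on `k` versus `K`.  Then for every `κ : Fin N → Fin 2` — every `E^a × B^b` — the Hodge conjecture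
holds for `⨁_j ![E, B] (κ j)`, GIVEN ONLY `Markman2025_weilClasses_algebraic_abelianFourfold` and `Markman2025_weilClasses_algebraic_hyperbolicSixfold` (`k ↪ K`: gen 19's
capstone; `k ↪̸ K`: the curve is foreign and splits off).  `HC_CM` is NOT asserted. [cite: MoonenZarhin1999LowDim, Thm. (0.1), (0.2), §3 (3.1), Cor. (3.9)]
[cite: Markman2025SurveySecant, Thm. 1.2 and §1.1] [cite: Markman2025SecantWeil, Thm 1.5.1] -/
theorem hodgeConjectureFor_biproduct_comp_vec_of_cmCurve_simpleFourfold_of_markman (hW4 : Markman2025_weilClasses_algebraic_abelianFourfold)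
    (hM6 : Markman2025_weilClasses_algebraic_hyperbolicSixfold) (h2 : Module.finrank ℚ k = 2) (h8 : Module.finrank ℚ K = 8) (hE : IsCMTypeRealisation Ψ E ιE θE)
    (hB : IsCMTypeRealisation Φ B ιB θB) (hS : B.IsSimple) (κ : Fin N → Fin 2) :
    HodgeConjectureFor (⨁ fun j => (![E, B] : Fin 2 → AbelianVariety ℂ) (κ j)).dim (⨁ fun j => (![E, B] : Fin 2 → AbelianVariety ℂ) (κ j)).X := by
  by_cases hkK : IsEmpty (k →+* K)
  · exact hodgeConjectureFor_biproduct_comp_vec_of_foreignCurve_simpleFourfold_of_markman hW4 h2 h8 hE hB hS hkK κ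
  · obtain ⟨i⟩ := not_isEmpty_iff.1 hkK
    have h := SimpleCMFourfoldCurve.hodgeConjectureFor_biproduct_comp_vec_of_isSimple_of_markman hW4 hM6 h8 h2 i hB hS hE (fun j => Equiv.swap (0 : Fin 2) 1 (κ j))
    rw [biproduct_vec_two_swap κ] at h
    exact h

/-- **`E × B` itself**, for ANY CM elliptic curve and ANY simple CM fourfold, given only Markman's two theorems. [cite: MoonenZarhin1999LowDim, Thm. (0.2)]
[cite: Markman2025SurveySecant, Thm. 1.2] [cite: Markman2025SecantWeil, Thm 1.5.1] -/
theorem hodgeConjectureFor_prod_of_cmCurve_simpleFourfold_of_markman (hW4 : Markman2025_weilClasses_algebraic_abelianFourfold)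
    (hM6 : Markman2025_weilClasses_algebraic_hyperbolicSixfold) (h2 : Module.finrank ℚ k = 2) (h8 : Module.finrank ℚ K = 8) (hE : IsCMTypeRealisation Ψ E ιE θE)
    (hB : IsCMTypeRealisation Φ B ιB θB) (hS : B.IsSimple) : HodgeConjectureFor (E.prod B).dim (E.prod B).X :=
  PairWeights.hodgeConjectureFor_prod_of_biproduct (A := (![E, B] : Fin 2 → AbelianVariety ℂ))
    (hodgeConjectureFor_biproduct_comp_vec_of_cmCurve_simpleFourfold_of_markman hW4 hM6 h2 h8 hE hB hS (id : Fin 2 → Fin 2))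

/-- **Dominated form**: everything dominated by some `E^a × B^b` (everything isogenous to such a product, every abelian subvariety or quotient of one), given only
Markman's two theorems. [cite: MoonenZarhin1999LowDim, Thm. (0.2)] [cite: Markman2025SurveySecant, Thm. 1.2] [cite: MumfordAV1970, §19 Thm. 1 and p. 169] -/
theorem hodgeConjectureFor_of_avDominatedBy_comp_vec_of_cmCurve_simpleFourfold_of_markman (hW4 : Markman2025_weilClasses_algebraic_abelianFourfold)
    (hM6 : Markman2025_weilClasses_algebraic_hyperbolicSixfold) (h2 : Module.finrank ℚ k = 2) (h8 : Module.finrank ℚ K = 8) (hE : IsCMTypeRealisation Ψ E ιE θE)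
    (hB : IsCMTypeRealisation Φ B ιB θB) (hS : B.IsSimple) (κ : Fin N → Fin 2) {X : AbelianVariety ℂ}
    (hX : Domination.AVDominatedBy X (⨁ fun j => (![E, B] : Fin 2 → AbelianVariety ℂ) (κ j))) : HodgeConjectureFor X.dim X.X :=
  Domination.hodgeConjectureFor_of_avDominatedBy (hodgeConjectureFor_biproduct_comp_vec_of_cmCurve_simpleFourfold_of_markman hW4 hM6 h2 h8 hE hB hS κ) hX

/-- **Every abelian variety ISOGENOUS TO A PRODUCT OF COPIES of `E` and `B`** (any finite index type), given only Markman's two theorems.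
[cite: MoonenZarhin1999LowDim, Thm. (0.2)] [cite: Markman2025SurveySecant, Thm. 1.2] [cite: MumfordAV1970, §19] -/
theorem hodgeConjectureFor_of_isIsogenous_biproduct_comp_of_cmCurve_simpleFourfold_of_markman (hW4 : Markman2025_weilClasses_algebraic_abelianFourfold)
    (hM6 : Markman2025_weilClasses_algebraic_hyperbolicSixfold) (h2 : Module.finrank ℚ k = 2) (h8 : Module.finrank ℚ K = 8) (hE : IsCMTypeRealisation Ψ E ιE θE)
    (hB : IsCMTypeRealisation Φ B ιB θB) (hS : B.IsSimple) {J : Type} [Fintype J] (cls : J → Fin 2) {X : AbelianVariety ℂ}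
    (hX : AbelianVariety.IsIsogenous X (⨁ fun j => (![E, B] : Fin 2 → AbelianVariety ℂ) (cls j))) : HodgeConjectureFor X.dim X.X := by
  classical
  let ε : Fin (Fintype.card J) ≃ J := (Fintype.equivFin J).symm
  have e : (⨁ fun j => (![E, B] : Fin 2 → AbelianVariety ℂ) (cls j)) ≅ ⨁ fun l => (![E, B] : Fin 2 → AbelianVariety ℂ) (cls (ε l)) :=
    (biproduct.reindex ε fun j => (![E, B] : Fin 2 → AbelianVariety ℂ) (cls j)).symm
  exact hodgeConjectureFor_of_avDominatedBy_comp_vec_of_cmCurve_simpleFourfold_of_markman hW4 hM6 h2 h8 hE hB hS (fun l => cls (ε l))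
    (Domination.AVDominatedBy.of_isIsogenous hX (Domination.AVDominatedBy.of_iso e (Domination.AVDominatedBy.refl _)))

/-! ### The roof: any CM elliptic curve × any simple CM abelian variety of dimension `≤ 4` -/

/-- **THE ROOF — ANY CM ELLIPTIC CURVE × ANY SIMPLE CM ABELIAN VARIETY OF DIMENSION `≤ 4`, given ONLY Markman's two theorems.**  `E ⊨ (k; Ψ)` a CM elliptic curve,
`B ⊨ (K; Φ)` SIMPLE of CM type with `dim B ≤ 4` (a CM curve, a simple CM surface, threefold or fourfold) — NOTHING else assumed.  Then for every `κ : Fin N → Fin 2` the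
Hodge conjecture holds for `⨁_j ![E, B] (κ j)` — every `E^a × B^b` — GIVEN ONLY `Markman2025_weilClasses_algebraic_abelianFourfold` and
`Markman2025_weilClasses_algebraic_hyperbolicSixfold` (dimension `≤ 3`: gen 31's G7, Markman 4 only for `(E, T)` with `k ↪ K_T`; dimension `4`: this file).
`HC_CM` is NOT asserted. [cite: MoonenZarhin1999LowDim, Thm. (0.1), (0.2)] [cite: Markman2025SurveySecant, Thm. 1.2 and §1.1] [cite: Markman2025SecantWeil, Thm 1.5.1] -/
theorem hodgeConjectureFor_biproduct_comp_vec_of_cmCurve_simple_dim_le_four_of_markman (hW4 : Markman2025_weilClasses_algebraic_abelianFourfold)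
    (hM6 : Markman2025_weilClasses_algebraic_hyperbolicSixfold) (h2 : Module.finrank ℚ k = 2) (hE : IsCMTypeRealisation Ψ E ιE θE) (hB : IsCMTypeRealisation Φ B ιB θB)
    (hS : B.IsSimple) (h4 : B.dim ≤ 4) (κ : Fin N → Fin 2) :
    HodgeConjectureFor (⨁ fun j => (![E, B] : Fin 2 → AbelianVariety ℂ) (κ j)).dim (⨁ fun j => (![E, B] : Fin 2 → AbelianVariety ℂ) (κ j)).X := by
  have hdimE : E.dim = 1 := by rw [AndreProductForm.dim_eq_of_isCMTypeRealisation hE, h2]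
  have hdimB : B.dim = Module.finrank ℚ K / 2 := AndreProductForm.dim_eq_of_isCMTypeRealisation hB
  have hK : Module.finrank ℚ K = 2 * B.dim := Literature.AlgebraicGeometry.Pohlmann1968.finrank_eq_two_mul_dim_of_isCMTypeRealisation hB
  by_cases h3 : B.dim ≤ 3
  · exact hodgeConjectureFor_biproduct_comp_vec_of_any_two_simple_dim_le_three_of_markman hW4 hE hB (AbelianVariety.isSimple_of_dim_le_one hdimE.le) hS
      (by rw [hdimE]; norm_num) h3 κ
  · have h8 : Module.finrank ℚ K = 8 := by rw [hK]; omega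
    exact hodgeConjectureFor_biproduct_comp_vec_of_cmCurve_simpleFourfold_of_markman hW4 hM6 h2 h8 hE hB hS κ

/-- **Dominated form of the roof**: everything dominated by a product of copies of a CM elliptic curve and a simple CM abelian variety of dimension `≤ 4`.
[cite: MoonenZarhin1999LowDim, Thm. (0.2)] [cite: Markman2025SurveySecant, Thm. 1.2] [cite: MumfordAV1970, §19 Thm. 1 and p. 169] -/
theorem hodgeConjectureFor_of_avDominatedBy_comp_vec_of_cmCurve_simple_dim_le_four_of_markman (hW4 : Markman2025_weilClasses_algebraic_abelianFourfold)
    (hM6 : Markman2025_weilClasses_algebraic_hyperbolicSixfold) (h2 : Module.finrank ℚ k = 2) (hE : IsCMTypeRealisation Ψ E ιE θE) (hB : IsCMTypeRealisation Φ B ιB θB)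
    (hS : B.IsSimple) (h4 : B.dim ≤ 4) (κ : Fin N → Fin 2) {X : AbelianVariety ℂ} (hX : Domination.AVDominatedBy X (⨁ fun j => (![E, B] : Fin 2 → AbelianVariety ℂ) (κ j))) :
    HodgeConjectureFor X.dim X.X :=
  Domination.hodgeConjectureFor_of_avDominatedBy (hodgeConjectureFor_biproduct_comp_vec_of_cmCurve_simple_dim_le_four_of_markman hW4 hM6 h2 hE hB hS h4 κ) hX

end CurveFourfold

end Summit.HodgeConjecture.CorCM.MultiFieldWeil

end
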